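import Summits.AtomisticToContinuum.HydrodynamicLimit.Theorems.MourreKoopmanChargesLinearToEntropyInBandDefsB
import Summits.AtomisticToContinuum.HydrodynamicLimit.Theorems.MourreKoopmanChargesLinearToEntropyInBandVisCoreNToolkitC
import Summits.AtomisticToContinuum.HydrodynamicLimit.Theorems.OneFlightGossipEngineKineticCurrentsWindowLDApriori
import Summits.AtomisticToContinuum.HydrodynamicLimit.Theorems.BoxDissipativeWeakStrongLocalGibbsFineScaleStaticsPrelim
import Summits.AtomisticToContinuum.HydrodynamicLimit.Theorems.TwoClocksClampedWindowDockActivityInversion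
import Summits.AtomisticToContinuum.HydrodynamicLimit.Theorems.JaynesSqueezeLocalGibbsConcentrationDiluteDensityLDA
import HarnessLib

/-!
# Route `MourreKoopmanCharges`, crux `LinearToEntropyInBand` (stmt-AtomisticToContinuum-17740), skeleton v7:
# mesoscopic block statics `MesoscopicBlockLD` — velocity integration of clause (ii) and band bookkeeping

Helper file (`--supports` the crux) for the registered helper target `stub_mesoscopicBlockLD :
LTEInBand.MesoscopicBlockLD` (objects module part B, § (d); folded into stub 4a-ii of skeleton v7).  The stub is
TRUE-grade STATICS of the explicit canonical local Gibbs reference family `ψ_s^N = localGibbsLaw σ (ρ₀_s · Rf(σ³ρ₀_s))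
(wv s) (ϑ s) N Φ` and is NOT closed here.  Landed:

* § 1 `lintegral_exp_mul_one_add_norm_sub_sq_gaussMeasure`: the exact Maxwellian moment
  `∫ exp(lam (1 + ‖v - u‖²)) dN(u, θ id) = e^{lam} (1 - 2 lam θ)^{-3/2}` on `ℝ³` (`2 lam θ < 1`), and the small-rate
  bound `e^{lam}(1 - 2 lam θ)^{-3/2} ≤ exp(lam (1 + 6Θ))` for `θ ≤ Θ`, `4 lam Θ ≤ 1` (`exp_mul_rpow_le_exp`);
* § 2 `lintegral_exp_mul_sum_ite_quadratic_le`: VELOCITY INTEGRATION under any local Gibbs measure — for a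
  position-only family of events `D(q, i)`, `∫ exp(lam Σᵢ 𝟙_D (1 + ‖vᵢ - u₀(qᵢ)‖²)) dP_N ≤
  ∫ exp(lam (1 + 6Θ) #{i : D}) d(posGibbsMeasure)` (disintegration `lintegral_localGibbsMeasure` /
  `LGFS.lintegral_localGibbsMeasure_le_of_vel`, independent Gaussian velocities given the positions);
* § 3 band bookkeeping of the reference family (the Lean junk audit of the stub): unit mass + pointwise guard
  `ρ₀σ³ < η` give `σ³ < η` (`pow_three_lt_of_guard`, so `σ < 1/2` at `η ≤ 1/8`); the reference activity
  `ρ₀ · Rf(σ³ρ₀)` is continuous and `≥ ρ₀` once `σ³ρ₀ ≤ r` (`continuous_refActivity`), the reference laws are then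
  probability measures for EVERY `N` (`isProbabilityMeasure_refLaw`: the `a = 0` / `lam → 0` corners are `1 ≤ 1`);
  the `R`-cone self-term is `3/(πR³)` (`inv_mul_cone_self`), so for `R` small against `ρ₀` every particle is dense
  (`lt_coneDensity_of_lt_self`: `R₀`/`K₀` must follow the profile, as they do); and THE REFERENCE DENSITY IS `ρ₀`:
  `rhoLim (profileOf (ρ₀ · Rf(σ³ρ₀))) σ = ρ₀` in the pointwise-guard form (`smallDensity_and_rhoLim_refActivity`,
  from `EntropyClockDock.activity_of_density`), so with `EntropyClockDock.densityLLN_of_smallDensity` the mean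
  `R`-cone density under `ψ` tends to `ρ₀(xᵢ)` and the `(5/4) ρ₀(xᵢ)` dense test of clause (ii) is a fixed factor
  ABOVE it (clause (ii) is not trivially false);
* § 4 the registered glue `glue_mesoscopicBlockLD_of_pos`: `MesoscopicBlockLD` follows from clause (i) (flow-free
  law) together with the POSITION-ONLY form of clause (ii) — an exponential moment, at one rate `c₀ > 0`, of the
  NUMBER of mesoscopically dense particles under the configurational Gibbs measure `posGibbsMeasure`;
* § 5 the registered bookkeeping conjunction `stub_mesoscopicBlockLDBand`.

No definition, no posited object; nothing restates the crux or a neighbour stub.  References: H. Spohn, *Large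
Scale Dynamics of Interacting Particles* (1991), Part I § 2.3, § 3.3; C. Kipnis, C. Landim, *Scaling Limits of
Interacting Particle Systems* (1999), App. 2; H.-O. Georgii, T. Küneth, J. Appl. Probab. 34 (1997) 868 (Poisson
domination of hard-core point processes, for the open position-only clause).
-/

noncomputable section

open MeasureTheory Filter Set
open scoped ENNReal Topology BigOperators

namespace Summit.AtomisticToContinuum.HydrodynamicLimit.Theorems.LTEInBand

open Literature.MathematicalPhysics.KineticTheory Literature.Analysis.FluidPDE

/-! ## § 1 One-particle Gaussian moment of the quadratic content `1 + ‖v - u‖²` -/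

/-- **Exact Maxwellian moment of the quadratic content.** For `θ > 0` and `2 lam θ < 1`,
`∫ exp(lam (1 + ‖v - u‖²)) dN(u, θ id) = e^{lam} (1 - 2 lam θ)^{-3/2}` on `ℝ³`. -/
theorem lintegral_exp_mul_one_add_norm_sub_sq_gaussMeasure {θ lam : ℝ} (hθ : 0 < θ) (h2 : 2 * lam * θ < 1)
    (u : V3) :
    ∫⁻ v, ENNReal.ofReal (Real.exp (lam * (1 + ‖v - u‖ ^ 2))) ∂gaussMeasure u θ =
      ENNReal.ofReal (Real.exp lam * (1 - 2 * lam * θ) ^ (-(3 : ℝ) / 2)) := by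
  have h := lintegral_exp_mul_norm_sub_sq_gaussMeasure (E := V3) hθ h2 u
  rw [finrank_euclideanSpace_fin] at h
  have hpt : ∀ v : V3, ENNReal.ofReal (Real.exp (lam * (1 + ‖v - u‖ ^ 2))) =
      ENNReal.ofReal (Real.exp lam) * ENNReal.ofReal (Real.exp (lam * ‖v - u‖ ^ 2)) := by
    intro v
    rw [← ENNReal.ofReal_mul (Real.exp_nonneg _), ← Real.exp_add]
    congr 2; ring
  simp_rw [hpt]
  rw [lintegral_const_mul' _ _ ENNReal.ofReal_ne_top, h, ← ENNReal.ofReal_mul (Real.exp_nonneg _)]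
  norm_num

/-- **Small-rate bound of the Maxwellian factor.** For `0 ≤ lam`, `0 < θ ≤ Θ` and `4 lam Θ ≤ 1`:
`e^{lam} (1 - 2 lam θ)^{-3/2} ≤ exp(lam (1 + 6 Θ))` (`-log(1 - x) ≤ 2x` on `[0, 1/2]`). -/
theorem exp_mul_rpow_le_exp {θ Θ lam : ℝ} (hlam : 0 ≤ lam) (hθ : 0 < θ) (hθΘ : θ ≤ Θ) (h4 : 4 * lam * Θ ≤ 1) :
    Real.exp lam * (1 - 2 * lam * θ) ^ (-(3 : ℝ) / 2) ≤ Real.exp (lam * (1 + 6 * Θ)) := by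
  have hΘ : 0 < Θ := hθ.trans_le hθΘ
  set x : ℝ := 2 * lam * θ with hx
  have hx0 : 0 ≤ x := by positivity
  have hxhalf : x ≤ 1 / 2 := by
    have : 2 * lam * θ ≤ 2 * lam * Θ := by gcongr
    linarith
  have h1x : 0 < 1 - x := by linarith
  -- `(1 - x)^{-3/2} = exp(-(3/2) log(1 - x)) ≤ exp(3x)`
  have hlog : -Real.log (1 - x) ≤ 2 * x := by
    have h := Real.log_le_sub_one_of_pos (inv_pos.2 h1x)
    rw [Real.log_inv] at h
    have hinv : (1 - x)⁻¹ - 1 ≤ 2 * x := by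
      rw [inv_eq_one_div, div_sub_one h1x.ne', div_le_iff₀ h1x]
      nlinarith
    linarith
  have hrpow : (1 - x) ^ (-(3 : ℝ) / 2) ≤ Real.exp (3 * x) := by
    rw [Real.rpow_def_of_pos h1x]
    refine Real.exp_le_exp.2 ?_
    nlinarith
  calc Real.exp lam * (1 - 2 * lam * θ) ^ (-(3 : ℝ) / 2) ≤ Real.exp lam * Real.exp (3 * x) :=
        mul_le_mul_of_nonneg_left hrpow (Real.exp_nonneg _)
    _ = Real.exp (lam + 3 * x) := (Real.exp_add _ _).symm
    _ ≤ Real.exp (lam * (1 + 6 * Θ)) := Real.exp_le_exp.2 (by rw [hx]; nlinarith)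


/-! ## § 2 Velocity integration under a local Gibbs law -/

/-- **VELOCITY INTEGRATION OF AN INDICATOR-WEIGHTED QUADRATIC VELOCITY CONTENT.**  Under the local Gibbs
measure with continuous profiles `(a₀ ≥ 0, u₀, 0 < θ₀ ≤ Θ)`, conditionally on the positions the velocities are
independent Maxwellians `N(u₀(qᵢ), θ₀(qᵢ) id)` (`lintegral_localGibbsMeasure`); for a POSITION-ONLY family of
events `D q i` (measurable in `q`) and a rate `0 ≤ lam` with `4 lam Θ ≤ 1`, each flagged particle contributes the
exact factor `e^{lam}(1 - 2 lam θ₀(qᵢ))^{-3/2} ≤ exp(lam (1 + 6Θ))` and each unflagged one the factor `1`, so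
`∫ exp(lam Σᵢ 𝟙_{D(q,i)} (1 + ‖vᵢ - u₀(qᵢ)‖²)) dP_N ≤ ∫ exp(lam (1 + 6Θ) · #{i : D(q,i)}) d(posGibbsMeasure)`:
the velocity content of the flagged particles is priced by their NUMBER under the configurational Gibbs measure. -/
theorem lintegral_exp_mul_sum_ite_quadratic_le {a₀ θ₀ : T3 → ℝ} {u₀ : T3 → V3}
    (ha : Continuous a₀) (hθ : Continuous θ₀) (hu : Continuous u₀) (ha0 : ∀ x, 0 ≤ a₀ x) (hθ0 : ∀ x, 0 < θ₀ x)
    (σ : ℝ) (N : ℕ) {Θ lam : ℝ} (hΘ : ∀ x, θ₀ x ≤ Θ) (hlam : 0 ≤ lam) (h4 : 4 * lam * Θ ≤ 1)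
    (D : (Fin (N + 1) → T3) → Fin (N + 1) → Prop) [∀ q i, Decidable (D q i)]
    (hD : ∀ i, MeasurableSet {q | D q i}) :
    ∫⁻ z, ENNReal.ofReal (Real.exp (lam * ∑ i, (if D (fun j => (z j).1) i then 1 + ‖(z i).2 - u₀ (z i).1‖ ^ 2 else 0)))
        ∂localGibbsMeasure σ a₀ u₀ θ₀ N ≤
      ∫⁻ q, ENNReal.ofReal (Real.exp (lam * (1 + 6 * Θ) * ∑ i, (if D q i then (1 : ℝ) else 0)))
        ∂posGibbsMeasure a₀ (hsDiameter σ N) (N + 1) := by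
  have hpos : Measurable fun (z : Config (N + 1) (Fin 3) T3) (j : Fin (N + 1)) => (z j).1 :=
    LGFS.measurable_posProj (N + 1)
  have hGm : Measurable fun z : Config (N + 1) (Fin 3) T3 => ENNReal.ofReal (Real.exp (lam * ∑ i,
      (if D (fun j => (z j).1) i then 1 + ‖(z i).2 - u₀ (z i).1‖ ^ 2 else 0))) := by
    refine (Real.measurable_exp.comp (measurable_const.mul (Finset.measurable_sum _ fun i _ => ?_))).ennreal_ofReal
    refine Measurable.ite ((hD i).preimage hpos) ?_ measurable_const
    exact measurable_const.add (((measurable_pi_apply i).snd.sub (hu.measurable.comp (measurable_pi_apply i).fst)).norm.pow_const 2)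
  have hbm : Measurable fun q : Fin (N + 1) → T3 => Real.exp (lam * (1 + 6 * Θ) * ∑ i, (if D q i then (1 : ℝ) else 0)) :=
    Real.measurable_exp.comp (measurable_const.mul (Finset.measurable_sum _ fun i _ =>
      Measurable.ite (hD i) measurable_const measurable_const))
  refine LGFS.lintegral_localGibbsMeasure_le_of_vel ha hθ hu ha0 hθ0 σ N hGm hbm fun q => ?_
  -- the integrand at fixed positions factorises over the particles
  set f : Fin (N + 1) → V3 → ℝ≥0∞ := fun i w =>
    ENNReal.ofReal (Real.exp (lam * (if D q i then 1 + ‖w - u₀ (q i)‖ ^ 2 else 0))) with hf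
  have hfm : ∀ i, Measurable (f i) := by
    intro i
    by_cases h : D q i
    · simp only [hf, h, if_true]; fun_prop
    · simp only [hf, h, if_false]; fun_prop
  have hfac : ∀ v : Fin (N + 1) → V3, ENNReal.ofReal (Real.exp (lam * ∑ i,
      (if D (fun j => (zipConfig (q, v) j).1) i then 1 + ‖(zipConfig (q, v) i).2 - u₀ (zipConfig (q, v) i).1‖ ^ 2
        else 0))) = ∏ i, f i (v i) := by
    intro v
    simp only [zipConfig_apply, hf]
    rw [Finset.mul_sum, Real.exp_sum, ENNReal.ofReal_prod_of_nonneg fun i _ => Real.exp_nonneg _]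
  simp_rw [hfac]
  rw [velMeasure, lintegral_fintype_prod_eq_prod' _ hfm, Finset.mul_sum, Real.exp_sum,
    ENNReal.ofReal_prod_of_nonneg fun i _ => Real.exp_nonneg _]
  refine Finset.prod_le_prod' fun i _ => ?_
  by_cases h : D q i
  · simp only [hf, h, if_true, mul_one]
    have h2 : 2 * lam * θ₀ (q i) < 1 := by nlinarith [hΘ (q i), hθ0 (q i)]
    rw [lintegral_exp_mul_one_add_norm_sub_sq_gaussMeasure (hθ0 (q i)) h2]
    exact ENNReal.ofReal_le_ofReal (exp_mul_rpow_le_exp hlam (hθ0 (q i)) (hΘ (q i)) h4)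
  · simp [hf, h]


/-! ## § 3 Band bookkeeping of the explicit reference family -/

/-- **The packing guard bounds the reduced diameter.**  If `ρ σ³ < η` pointwise for a continuous density `ρ`
of unit mass and `0 ≤ σ`, then `σ³ < η` (evaluate at a point where `ρ ≥ 1`,
`LocalGibbsConcentration.exists_one_le_of_integral_eq_one`); in particular the guard of
`MesoscopicBlockLD` with `η ≤ 1/8` forces `σ < 1/2`, the normalisability range of the local Gibbs laws. -/
theorem pow_three_lt_of_guard {ρ : T3 → ℝ} (hρ : Continuous ρ) (h1 : ∫ x, ρ x = 1) {σ η : ℝ} (hσ : 0 ≤ σ)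
    (hg : ∀ x, ρ x * σ ^ 3 < η) : σ ^ 3 < η := by
  obtain ⟨x, hx⟩ := LocalGibbsConcentration.exists_one_le_of_integral_eq_one hρ h1
  calc σ ^ 3 = 1 * σ ^ 3 := (one_mul _).symm
    _ ≤ ρ x * σ ^ 3 := mul_le_mul_of_nonneg_right hx (pow_nonneg hσ 3)
    _ < η := hg x

/-- `σ < 1/2` from the guard at level `η ≤ 1/8`. -/
theorem lt_half_of_guard {ρ : T3 → ℝ} (hρ : Continuous ρ) (h1 : ∫ x, ρ x = 1) {σ η : ℝ} (hσ : 0 ≤ σ)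
    (hη : η ≤ 1 / 8) (hg : ∀ x, ρ x * σ ^ 3 < η) : σ < 1 / 2 := by
  have h := (pow_three_lt_of_guard hρ h1 hσ hg).trans_le hη
  exact lt_of_pow_lt_pow_left₀ 3 (by norm_num) (by norm_num at h ⊢; linarith)

/-- Sections of a family continuous on the slab `[0, t₁] × 𝕋³` are continuous. -/
theorem continuous_section {X : Type*} [TopologicalSpace X] {F : ℝ → T3 → X} {t₁ : ℝ}
    (hF : ContinuousOn (Function.uncurry F) (Set.Icc 0 t₁ ×ˢ Set.univ)) {s : ℝ} (hs : s ∈ Set.Icc 0 t₁) :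
    Continuous (F s) :=
  hF.comp_continuous (continuous_const.prodMk continuous_id) fun x => ⟨hs, mem_univ x⟩

/-- A real family continuous on the slab `[0, t₁] × 𝕋³` is bounded above there by a positive constant. -/
theorem exists_pos_forall_le_of_continuousOn_slab {F : ℝ → T3 → ℝ} {t₁ : ℝ}
    (hF : ContinuousOn (Function.uncurry F) (Set.Icc 0 t₁ ×ˢ Set.univ)) :
    ∃ Θ : ℝ, 0 < Θ ∧ ∀ s ∈ Set.Icc 0 t₁, ∀ x, F s x ≤ Θ := by
  obtain ⟨B, hB⟩ := (isCompact_Icc.prod isCompact_univ).bddAbove_image hF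
  refine ⟨max B 1, lt_max_of_lt_right one_pos, fun s hs x => le_max_of_le_left ?_⟩
  exact (mem_upperBounds.1 hB) _ ⟨(s, x), ⟨hs, mem_univ x⟩, rfl⟩

/-- **The explicit reference activity is continuous and positive in the band.**  For an insertion factor
`Rf` continuous and `≥ 1` on `[0, r]` and a continuous density `ρ > 0` with `σ³ ρ ≤ r` (`0 ≤ σ`), the activity
`x ↦ ρ(x) Rf(σ³ ρ(x))` of the window clause's reference law is continuous and bounded below by `ρ`. -/
theorem continuous_refActivity {r : ℝ} {Rf : ℝ → ℝ} (hcont : ContinuousOn Rf (Set.Icc 0 r))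
    (hbd : ∀ x ∈ Set.Icc 0 r, 1 ≤ Rf x ∧ Rf x ≤ 2) {ρ : T3 → ℝ} (hρ : Continuous ρ) (hρ0 : ∀ x, 0 < ρ x) {σ : ℝ}
    (hσ : 0 ≤ σ) (hr : ∀ x, ρ x * σ ^ 3 ≤ r) :
    (Continuous fun x => ρ x * Rf (σ ^ 3 * ρ x)) ∧ ∀ x, ρ x ≤ ρ x * Rf (σ ^ 3 * ρ x) := by
  have hmem : ∀ x, σ ^ 3 * ρ x ∈ Set.Icc 0 r := fun x =>
    ⟨mul_nonneg (pow_nonneg hσ 3) (hρ0 x).le, (mul_comm (σ ^ 3) (ρ x)).trans_le (hr x)⟩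
  exact ⟨hρ.mul (hcont.comp_continuous (continuous_const.mul hρ) hmem),
    fun x => le_mul_of_one_le_right (hρ0 x).le (hbd _ (hmem x)).1⟩

/-- **The reference laws are probability measures in the band**: with the activity of `continuous_refActivity`,
continuous `ϑ > 0`, `wv`, and `σ ≤ 1/2`, `localGibbsMeasure σ (ρ · Rf(σ³ρ)) wv ϑ N` has mass one for EVERY `N`
(`isProbabilityMeasure_localGibbsMeasure`), so the `a = 0` / `lam → 0` corners of `MesoscopicBlockLD` are `1 ≤ 1`. -/
theorem isProbabilityMeasure_refLaw {r : ℝ} {Rf : ℝ → ℝ} (hcont : ContinuousOn Rf (Set.Icc 0 r))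
    (hbd : ∀ x ∈ Set.Icc 0 r, 1 ≤ Rf x ∧ Rf x ≤ 2) {ρ ϑ : T3 → ℝ} {wv : T3 → V3} (hρ : Continuous ρ)
    (hρ0 : ∀ x, 0 < ρ x) (hϑ : Continuous ϑ) (hϑ0 : ∀ x, 0 < ϑ x) (hwv : Continuous wv) {σ : ℝ} (hσ : 0 ≤ σ)
    (hσ2 : σ ≤ 1 / 2) (hr : ∀ x, ρ x * σ ^ 3 ≤ r) (N : ℕ) :
    IsProbabilityMeasure (localGibbsMeasure σ (fun x => ρ x * Rf (σ ^ 3 * ρ x)) wv ϑ N) := by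
  obtain ⟨ha, hale⟩ := continuous_refActivity hcont hbd hρ hρ0 hσ hr
  exact isProbabilityMeasure_localGibbsMeasure ha hϑ hwv (fun x => (hρ0 x).trans_le (hale x)) hϑ0 hσ2 N

/-- **Self-term of the cone density.**  `(N+1)⁻¹ cone R N x x = 3 / (π R³)`: each particle sees itself in its own
`R`-cone with the `N`-independent weight `3/(πR³)` (`= 0` at `R = 0` by `x/0 = 0`). -/
theorem inv_mul_cone_self (R : ℝ) (N : ℕ) (x : T3) : ((N : ℝ) + 1)⁻¹ * cone R N x x = 3 / (Real.pi * R ^ 3) := by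
  have hN : (0 : ℝ) < (N : ℝ) + 1 := by positivity
  have h3 : (((N : ℝ) + 1) ^ (-(1 / 3 : ℝ))) ^ 3 = ((N : ℝ) + 1)⁻¹ := by
    rw [← Real.rpow_natCast, ← Real.rpow_mul hN.le]
    norm_num
    exact Real.rpow_neg_one _
  unfold cone
  rw [Torus.euclidDist_self, zero_div, sub_zero, max_eq_right zero_le_one, mul_one, mul_pow, h3]
  by_cases hR : R = 0
  · subst hR; simp
  · field_simp

/-- **Small cones make every particle dense.**  If `c < 3/(πR³)` then `c` lies below the `R`-cone density
`(N+1)⁻¹ Σⱼ cone R N qᵢ qⱼ` of EVERY particle in EVERY configuration (the self-term alone exceeds it; `0 ≤ R`):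
the radius `R₀` of clause (ii) / the threshold `K₀` of clause (i) must be allowed to depend on the profile
`ρ₀` (they are chosen after it), e.g. `3/(πR₀³) ≪ min ρ₀ / 4`. -/
theorem lt_coneDensity_of_lt_self {R c : ℝ} (hR : 0 ≤ R) (hc : c < 3 / (Real.pi * R ^ 3)) {N : ℕ}
    (q : Fin (N + 1) → T3) (i : Fin (N + 1)) : c < ((N : ℝ) + 1)⁻¹ * ∑ j, cone R N (q i) (q j) := by
  have h1 : cone R N (q i) (q i) ≤ ∑ j, cone R N (q i) (q j) :=
    Finset.single_le_sum (f := fun j => cone R N (q i) (q j)) (fun j _ => cone_nonneg N hR _ _) (Finset.mem_univ i)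
  calc c < 3 / (Real.pi * R ^ 3) := hc
    _ = ((N : ℝ) + 1)⁻¹ * cone R N (q i) (q i) := (inv_mul_cone_self R N (q i)).symm
    _ ≤ ((N : ℝ) + 1)⁻¹ * ∑ j, cone R N (q i) (q j) := mul_le_mul_of_nonneg_left h1 (by positivity)

/-- **THE REFERENCE DENSITY IS `ρ₀` (activity inversion in guard form).**  For an insertion factor `Rf` as in
the `(r, Rf)` prefix of `MesoscopicBlockLD` and a continuous density `ρ > 0` of unit mass whose packing guard
`ρ σ³ < η₁ := min (r/(8e+4)) (1/(64 e v₁)) ⊓ 1/8` holds pointwise (`0 < σ`), the explicit activity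
`a = ρ · Rf(σ³ρ)` is in the statics regime `SmallDensity (profileOf a) σ` and the thermodynamic-limit density of
its canonical hard-sphere laws is EXACTLY `ρ`: `rhoLim (profileOf a) σ = ρ` (`EntropyClockDock.activity_of_density`,
the sup-packing hypothesis there following from the pointwise strict guard).  With the density law of large
numbers in the statics regime (`EntropyClockDock.densityLLN_of_smallDensity`) this certifies that the mean
`R`-cone density under the reference law tends to `ρ₀(xᵢ) < (5/4) ρ₀(xᵢ)`: the dense test of clause (ii) sits
a fixed factor ABOVE the reference mean, as the docstring of `MesoscopicBlockLD` claims. -/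
theorem smallDensity_and_rhoLim_refActivity {r : ℝ} {Rf : ℝ → ℝ} (hr : 0 < r)
    (hsol : ∀ x ∈ Set.Ioo (-r) r, 0 < Rf x ∧ Rf x * (∑' j : ℕ, bE j / (j.factorial : ℝ) * (x * Rf x) ^ j) = 1)
    (hbd : ∀ x ∈ Set.Icc 0 r, 1 ≤ Rf x ∧ Rf x ≤ 2) (hcont : ContinuousOn Rf (Set.Icc 0 r))
    (huniq : ∀ x ∈ Set.Ioo (-r) r, ∀ R ∈ Set.Icc (1 / 2 : ℝ) 2,
      R * (∑' j : ℕ, bE j / (j.factorial : ℝ) * (x * R) ^ j) = 1 → R = Rf x)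
    {σ : ℝ} (hσ : 0 < σ) {ρ : T3 → ℝ} (hρc : Continuous ρ) (hρ0 : ∀ x, 0 < ρ x) (hρ1 : ∫ x, ρ x = 1)
    (hguard : ∀ x, ρ x * σ ^ 3 <
      min (min (r / (2 * (2 * (2 * Real.exp 1 + 1)))) (1 / (64 * Real.exp 1 * v₁))) (1 / 8)) :
    ∃ (ha : Continuous fun x => ρ x * Rf (σ ^ 3 * ρ x)) (ha0 : ∀ x, 0 < ρ x * Rf (σ ^ 3 * ρ x)),
      SmallDensity (profileOf (fun x => ρ x * Rf (σ ^ 3 * ρ x)) ha ha0) σ ∧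
      rhoLim (profileOf (fun x => ρ x * Rf (σ ^ 3 * ρ x)) ha ha0) σ = ρ := by
  set m : ℝ := min (r / (2 * (2 * (2 * Real.exp 1 + 1)))) (1 / (64 * Real.exp 1 * v₁)) with hm
  have hσ2 : σ < 1 / 2 :=
    lt_half_of_guard hρc hρ1 hσ.le (min_le_right m _) hguard
  have hσ3 : 0 < σ ^ 3 := pow_pos hσ 3
  have hsup : σ ^ 3 * (⨆ x, ρ x) ≤ m := by
    have hb : ∀ x, ρ x ≤ m / σ ^ 3 := fun x => by
      rw [le_div_iff₀ hσ3]
      exact ((hguard x).trans_le (min_le_left _ _)).le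
    calc σ ^ 3 * (⨆ x, ρ x) ≤ σ ^ 3 * (m / σ ^ 3) := mul_le_mul_of_nonneg_left (ciSup_le hb) hσ3.le
      _ = m := mul_div_cancel₀ m hσ3.ne'
  obtain ⟨ha, ha0, -, hS, hlim⟩ :=
    EntropyClockDock.activity_of_density hr hsol hbd hcont huniq hσ hσ2 hρc hρ0 hρ1 hsup
  exact ⟨ha, ha0, hS, hlim⟩


/-! ## § 4 The registered glue: `MesoscopicBlockLD` from clause (i) and the POSITION-ONLY form of clause (ii) -/

/-- **Registered glue stub `glue_mesoscopicBlockLD_of_pos`** (crux stmt-17740, skeleton v7, helper target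
`stub_mesoscopicBlockLD`).  `MesoscopicBlockLD` follows from the conjunction, under ITS OWN `(r, Rf)` prefix, packing
level `η₀` and family hypotheses (verbatim), of
(i) clause (i) verbatim but under the FLOW-FREE law `localGibbsMeasure σ (ρ₀_s · Rf(σ³ρ₀_s)) (wv s) (ϑ s) N` (no
`∀ Φ`: `localGibbsLaw_eq`), and
(ii-pos) the POSITION-ONLY form of clause (ii): `∃ c₀ > 0 ∀ ε > 0 ∃ R₀ > 0 ∀ R ≥ R₀ ∃ N₀ ∀ N ≥ N₀ ∀ s ∈ [0, t₁]`,
`∫ exp(c₀ · #{i : (5/4) ρ₀_s(qᵢ) < (N+1)⁻¹ Σⱼ cone R N qᵢ qⱼ}) d(posGibbsMeasure (ρ₀_s · Rf(σ³ρ₀_s)) ε_N (N+1)) ≤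
exp(ε (N+1))` — an exponential moment of the NUMBER of mesoscopically dense particles under the configurational
canonical hard-sphere Gibbs measure, at ONE rate `c₀` (the moment is monotone in the rate).
Proof: `η₀ := min η₀' r` (so that `σ³ρ₀ ≤ r` and the reference activity is continuous, `continuous_refActivity`);
(i) is rewritten by `localGibbsLaw_eq`; for (ii), with `Θ ≥ sup ϑ` on the slab
(`exists_pos_forall_le_of_continuousOn_slab`) take `lam₀ := min (1/(4Θ)) (c₀/(1 + 6Θ))`: for `0 < lam ≤ lam₀` the
velocities integrate out by `lintegral_exp_mul_sum_ite_quadratic_le` at rate `lam (1 + 6Θ) ≤ c₀`, and (ii-pos)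
concludes.  What remains of `stub_mesoscopicBlockLD` is exactly the hypothesis of this glue (TRUE-grade statics:
CLT-scale block moments (i), and the dense-count moment (ii-pos) — Poisson-type moderate deviations of `R`-cone
counts of the dilute hard-sphere gas below the clump cost rate). -/
theorem glue_mesoscopicBlockLD_of_pos : (∀ (r : ℝ) (Rf : ℝ → ℝ), 0 < r → (∃ p : FormalMultilinearSeries ℝ ℝ ℝ, HasFPowerSeriesOnBall Rf p 0 (ENNReal.ofReal r)) → (∃ L : NNReal, LipschitzOnWith L Rf (Set.Icc 0 r)) → (∀ x ∈ Set.Ioo (-r) r, 0 < Rf x ∧ Rf x * (∑' j : ℕ, Literature.MathematicalPhysics.KineticTheory.bE j / (j.factorial : ℝ) * (x * Rf x) ^ j) = 1) → (∀ x ∈ Set.Icc 0 r, 1 ≤ Rf x ∧ Rf x ≤ 2) → ContinuousOn Rf (Set.Icc 0 r) → (∀ x ∈ Set.Ioo (-r) r, ∀ R ∈ Set.Icc (1 / 2 : ℝ) 2, R * (∑' j : ℕ, Literature.MathematicalPhysics.KineticTheory.bE j / (j.factorial : ℝ) * (x * R) ^ j) = 1 → R = Rf x) → ∃ η₀ : ℝ,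 0 < η₀ ∧ ∀ (t₁ : ℝ) (ρ₀ ϑ : ℝ → Literature.MathematicalPhysics.KineticTheory.T3 → ℝ) (wv : ℝ → Literature.MathematicalPhysics.KineticTheory.T3 → Literature.MathematicalPhysics.KineticTheory.V3), ContinuousOn (Function.uncurry ρ₀) (Set.Icc 0 t₁ ×ˢ Set.univ) → ContinuousOn (Function.uncurry ϑ) (Set.Icc 0 t₁ ×ˢ Set.univ) → ContinuousOn (Function.uncurry wv) (Set.Icc 0 t₁ ×ˢ Set.univ) → (∀ s ∈ Set.Icc 0 t₁, ∀ x, 0 < ρ₀ s x) → (∀ s ∈ Set.Icc 0 t₁, ∀ x, 0 < ϑ s x) → (∀ s ∈ Set.Icc 0 t₁, ∫ x, ρ₀ s x = 1) → ∀ σ : ℝ, 0 < σ → (∀ s ∈ Set.Icc 0 t₁, ∀ x, ρ₀ s x * σ ^ 3 < η₀) → (∃ a₀ : ℝ, 0 < a₀ ∧ ∃ C : ℝ, 0 ≤ C ∧ ∀ ε : ℝ, 0 < ε → ∃ K₀ : ℝ, ∀ K : ℝ, K₀ ≤ K → ∀ R : ℝ, K₀ ≤ R → ∃ k₀ : ℝ,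 0 < k₀ ∧ ∀ k : ℝ, k₀ ≤ k → ∃ N₀ : ℕ, ∀ N : ℕ, N₀ ≤ N → ∀ s ∈ Set.Icc 0 t₁, ∀ a ∈ Set.Icc 0 a₀, ∫⁻ z, ENNReal.ofReal (Real.exp (a * (((N : ℝ) + 1) * ∫ x, ((Summit.AtomisticToContinuum.HydrodynamicLimit.Theorems.LTEInBand.visDensityN (ρ₀ s) (wv s) R K k N z x - ρ₀ s x) ^ 2 + ‖Summit.AtomisticToContinuum.HydrodynamicLimit.Theorems.LTEInBand.visMomentumN (ρ₀ s) (wv s) R K k N z x - ρ₀ s x • wv s x‖ ^ 2)))) ∂(Literature.MathematicalPhysics.KineticTheory.localGibbsMeasure σ (fun x => ρ₀ s x * Rf (σ ^ 3 * ρ₀ s x)) (wv s) (ϑ s) N) ≤ ENNReal.ofReal (Real.exp (a * (((N : ℝ) + 1) * (C / k ^ 3 + ε))))) ∧ (∃ c₀ : ℝ, 0 < c₀ ∧ ∀ ε : ℝ, 0 < ε → ∃ R₀ : ℝ, 0 < R₀ ∧ ∀ R : ℝ, R₀ ≤ R → ∃ N₀ : ℕ, ∀ N : ℕ, N₀ ≤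 N → ∀ s ∈ Set.Icc 0 t₁, ∫⁻ q, ENNReal.ofReal (Real.exp (c₀ * ∑ i : Fin (N + 1), (if 5 / 4 * ρ₀ s (q i) < ((N : ℝ) + 1)⁻¹ * ∑ j : Fin (N + 1), Summit.AtomisticToContinuum.HydrodynamicLimit.Theorems.LTEInBand.cone R N (q i) (q j) then (1 : ℝ) else 0))) ∂(Literature.MathematicalPhysics.KineticTheory.posGibbsMeasure (fun x => ρ₀ s x * Rf (σ ^ 3 * ρ₀ s x)) (Literature.MathematicalPhysics.KineticTheory.hsDiameter σ N) (N + 1)) ≤ ENNReal.ofReal (Real.exp (ε * ((N : ℝ) + 1))))) → Summit.AtomisticToContinuum.HydrodynamicLimit.Theorems.LTEInBand.MesoscopicBlockLD := by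
  intro H r Rf hr hp hL hsol hbd hcont huniq
  obtain ⟨η₁, hη₁, G⟩ := H r Rf hr hp hL hsol hbd hcont huniq
  refine ⟨min η₁ r, lt_min hη₁ hr, fun t₁ ρ₀ ϑ wv hρc hϑc hwc hρ0 hϑ0 hmass σ hσ hguard => ?_⟩
  have hguard₁ : ∀ s ∈ Set.Icc 0 t₁, ∀ x, ρ₀ s x * σ ^ 3 < η₁ := fun s hs x =>
    (hguard s hs x).trans_le (min_le_left _ _)
  have hguardr : ∀ s ∈ Set.Icc 0 t₁, ∀ x, ρ₀ s x * σ ^ 3 ≤ r := fun s hs x =>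
    ((hguard s hs x).trans_le (min_le_right _ _)).le
  obtain ⟨hI, c₀, hc₀, hII⟩ := G t₁ ρ₀ ϑ wv hρc hϑc hwc hρ0 hϑ0 hmass σ hσ hguard₁
  obtain ⟨Θ, hΘ, hϑΘ⟩ := exists_pos_forall_le_of_continuousOn_slab hϑc
  refine ⟨?_, ?_⟩
  · -- clause (i): the laws do not depend on the flow
    obtain ⟨a₁, ha₁, C, hC, h⟩ := hI
    refine ⟨a₁, ha₁, C, hC, fun ε hε => ?_⟩
    obtain ⟨K₀, hK⟩ := h ε hε
    refine ⟨K₀, fun K hKK R hRR => ?_⟩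
    obtain ⟨k₀, hk₀, hk⟩ := hK K hKK R hRR
    refine ⟨k₀, hk₀, fun k hkk => ?_⟩
    obtain ⟨N₀, hN⟩ := hk k hkk
    refine ⟨N₀, fun N hNN Φ s hs a ha => ?_⟩
    rw [localGibbsLaw_eq]
    exact hN N hNN s hs a ha
  · -- clause (ii): integrate out the velocities, then (ii-pos)
    refine ⟨min (1 / (4 * Θ)) (c₀ / (1 + 6 * Θ)), lt_min (by positivity) (by positivity),
      fun lam hlam hlamle ε hε => ?_⟩
    obtain ⟨R₀, hR₀, hR⟩ := hII ε hε
    refine ⟨R₀, hR₀, fun R hRR => ?_⟩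
    obtain ⟨N₀, hN⟩ := hR R hRR
    refine ⟨N₀, fun N hNN Φ s hs => ?_⟩
    rw [localGibbsLaw_eq]
    have hρs : Continuous (ρ₀ s) := continuous_section hρc hs
    have hϑs : Continuous (ϑ s) := continuous_section hϑc hs
    have hws : Continuous (wv s) := continuous_section hwc hs
    obtain ⟨has, hale⟩ := continuous_refActivity hcont hbd hρs (hρ0 s hs) hσ.le (hguardr s hs)
    have has0 : ∀ x, 0 ≤ ρ₀ s x * Rf (σ ^ 3 * ρ₀ s x) := fun x => ((hρ0 s hs x).le).trans (hale x)
    have h4 : 4 * lam * Θ ≤ 1 := by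
      have h1 : lam ≤ 1 / (4 * Θ) := hlamle.trans (min_le_left _ _)
      rw [le_div_iff₀ (by positivity)] at h1
      linarith
    have hrate : lam * (1 + 6 * Θ) ≤ c₀ := by
      have h1 : lam ≤ c₀ / (1 + 6 * Θ) := hlamle.trans (min_le_right _ _)
      rwa [le_div_iff₀ (by positivity)] at h1
    have hDm : ∀ i : Fin (N + 1), MeasurableSet {q : Fin (N + 1) → T3 |
        5 / 4 * ρ₀ s (q i) < ((N : ℝ) + 1)⁻¹ * ∑ j : Fin (N + 1), cone R N (q i) (q j)} := fun i =>
      measurableSet_lt (measurable_const.mul (hρs.measurable.comp (measurable_pi_apply i)))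
        (measurable_const.mul (Finset.measurable_sum _ fun j _ =>
          measurable_cone_comp R N (measurable_pi_apply i) (measurable_pi_apply j)))
    have hvel := lintegral_exp_mul_sum_ite_quadratic_le has hϑs hws has0 (hϑ0 s hs) σ N (fun x => hϑΘ s hs x)
      hlam.le h4 (fun q i => 5 / 4 * ρ₀ s (q i) < ((N : ℝ) + 1)⁻¹ * ∑ j : Fin (N + 1), cone R N (q i) (q j)) hDm
    refine hvel.trans ((lintegral_mono fun q => ENNReal.ofReal_le_ofReal (Real.exp_le_exp.2 ?_)).trans (hN N hNN s hs))
    exact mul_le_mul_of_nonneg_right hrate (Finset.sum_nonneg fun i _ => by split_ifs <;> norm_num)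


/-! ## § 5 The registered band-bookkeeping stub -/

/-- **Registered bookkeeping stub `stub_mesoscopicBlockLDBand`** (crux stmt-17740, skeleton v7; the junk audit of
`MesoscopicBlockLD` in Lean): (a) the reference density IS `ρ₀` — activity inversion in the pointwise-guard form of
the stub (`smallDensity_and_rhoLim_refActivity`: the `(5/4) ρ₀` dense test sits above the reference mean density);
(b) the reference laws are probability measures for every `N` once `σ ≤ 1/2` and `σ³ρ₀ ≤ r`
(`isProbabilityMeasure_refLaw`: the `a = 0` / `lam → 0` corners are `1 ≤ 1`, no normalisation junk; `σ < 1/2`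
follows from the guard at level `≤ 1/8`, `lt_half_of_guard`); (c) the `R`-cone self-term `3/(πR³)` makes every
particle dense / invisible when `R` is small against `ρ₀` (`lt_coneDensity_of_lt_self`: `R₀`, `K₀` are rightly
chosen after the profile).  Sorry-free conjunction. -/
theorem stub_mesoscopicBlockLDBand : (∀ (r : ℝ) (Rf : ℝ → ℝ), 0 < r → (∀ x ∈ Set.Ioo (-r) r, 0 < Rf x ∧ Rf x * (∑' j : ℕ, Literature.MathematicalPhysics.KineticTheory.bE j / (j.factorial : ℝ) * (x * Rf x) ^ j) = 1) → (∀ x ∈ Set.Icc 0 r, 1 ≤ Rf x ∧ Rf x ≤ 2) → ContinuousOn Rf (Set.Icc 0 r) → (∀ x ∈ Set.Ioo (-r) r, ∀ R ∈ Set.Icc (1 / 2 : ℝ) 2, R * (∑' j : ℕ, Literature.MathematicalPhysics.KineticTheory.bE j / (j.factorial : ℝ) * (x * R) ^ j) = 1 → R = Rf x) → ∀ σ : ℝ, 0 < σ → ∀ ρ : Literature.MathematicalPhysics.KineticTheory.T3 → ℝ, Continuous ρ → (∀ x, 0 < ρ x) → (∫ x, ρ x = 1) → (∀ x, ρ x *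 σ ^ 3 < min (min (r / (2 * (2 * (2 * Real.exp 1 + 1)))) (1 / (64 * Real.exp 1 * Literature.MathematicalPhysics.KineticTheory.v₁))) (1 / 8)) → ∃ (ha : Continuous fun x => ρ x * Rf (σ ^ 3 * ρ x)) (ha0 : ∀ x, 0 < ρ x * Rf (σ ^ 3 * ρ x)), Literature.MathematicalPhysics.KineticTheory.SmallDensity (Literature.MathematicalPhysics.KineticTheory.profileOf (fun x => ρ x * Rf (σ ^ 3 * ρ x)) ha ha0) σ ∧ Literature.MathematicalPhysics.KineticTheory.rhoLim (Literature.MathematicalPhysics.KineticTheory.profileOf (fun x => ρ x * Rf (σ ^ 3 * ρ x)) ha ha0) σ = ρ) ∧ (∀ (r : ℝ) (Rf : ℝ → ℝ), ContinuousOn Rf (Set.Icc 0 r) → (∀ x ∈ Set.Icc 0 r, 1 ≤ Rf x ∧ Rf x ≤ 2) → ∀ (ρ ϑ : Literature.MathematicalPhysics.KineticTheory.T3 → ℝ) (wv : Literature.MathematicalPhysics.KineticTheory.T3 → Literature.MathematicalPhysics.KineticTheory.V3), Continuous ρ → (∀ x, 0 < ρ x) → Continuous ϑ → (∀ x, 0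 < ϑ x) → Continuous wv → ∀ σ : ℝ, 0 ≤ σ → σ ≤ 1 / 2 → (∀ x, ρ x * σ ^ 3 ≤ r) → ∀ N : ℕ, MeasureTheory.IsProbabilityMeasure (Literature.MathematicalPhysics.KineticTheory.localGibbsMeasure σ (fun x => ρ x * Rf (σ ^ 3 * ρ x)) wv ϑ N)) ∧ (∀ (R c : ℝ), 0 ≤ R → c < 3 / (Real.pi * R ^ 3) → ∀ (N : ℕ) (q : Fin (N + 1) → Literature.MathematicalPhysics.KineticTheory.T3) (i : Fin (N + 1)), c < ((N : ℝ) + 1)⁻¹ * ∑ j : Fin (N + 1), Summit.AtomisticToContinuum.HydrodynamicLimit.Theorems.LTEInBand.cone R N (q i) (q j)) :=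
  ⟨fun _ _ hr hsol hbd hcont huniq _ hσ _ hρc hρ0 hρ1 hguard =>
      smallDensity_and_rhoLim_refActivity hr hsol hbd hcont huniq hσ hρc hρ0 hρ1 hguard,
    fun _ _ hcont hbd _ _ _ hρ hρ0 hϑ hϑ0 hwv _ hσ hσ2 hr N =>
      isProbabilityMeasure_refLaw hcont hbd hρ hρ0 hϑ hϑ0 hwv hσ hσ2 hr N,
    fun _ _ hR hc _ q i => lt_coneDensity_of_lt_self hR hc q i⟩

end Summit.AtomisticToContinuum.HydrodynamicLimit.Theorems.LTEInBand

end
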